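import Mathlib.Algebra.Group.Submonoid.Operations
import Mathlib.Data.PNat.Basic
import Mathlib.GroupTheory.QuotientGroup.Basic
import Mathlib.GroupTheory.FreeGroup.IsFreeGroup
import Mathlib.GroupTheory.GroupAction.Basic
import Mathlib.Topology.Algebra.Group.Basic
import Mathlib.Topology.Algebra.ContinuousMonoidHom
import Mathlib.CategoryTheory.Comma.Arrow
import Mathlib.CategoryTheory.ObjectProperty.FullSubcategory
import Mathlib.CategoryTheory.EssentialImage
import Mathlib.CategoryTheory.Types.Basic
import Literature.AlgebraicGeometry.Frobenioids.Monoids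
import Literature.AlgebraicGeometry.Frobenioids.CategoriesFactorization

/-!
# [EtTh] §0 "Notations and Conventions" (Mochizuki 2009, PRIMS 45), PDF pp. 8–10 (printed 234–236)

Source: S. Mochizuki, *The étale theta function and its Frobenioid-theoretic manifestations*,
Publ. RIMS 45 (2009) [MochizukiEtTh2009], §0. Locators `p.N` are PDF pages of the PRIMS text
(printed page `N + 226`). The section adds to the conventions of [FrdI] §0
(`Literature/AlgebraicGeometry/Frobenioids/{Monoids,Categories,CategoriesFactorization}.lean`,
[MochizukiFrdI2008]) the following items, typed here one declaration per printed notion: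

* **Monoids** (p.8): `ℕ_{≥1}` (= `Literature.AlgebraicGeometry.Frobenioids.NgeOne`, not
  re-declared); the *group-saturation* `P^gp ∩ Q` and the *perf-saturation* `P^pf ∩ Q` of a
  submonoid `P ⊆ Q`, *group-saturated* / *perf-saturated* submonoids. We write monoids
  multiplicatively (as the Frobenioids files do); the text's `Q^gp`, `Q^pf` are
  `Algebra.GrothendieckGroup Q`, `Literature.AlgebraicGeometry.Frobenioids.Perfection Q`. The
  saturations are defined by the elementary membership conditions `q * b = a` (`a b ∈ P`) resp.
  `q ^ n ∈ P` (`n ≥ 1`), which is what `P^gp ∩ Q` resp. `P^pf ∩ Q` means once `Q ↪ Q^gp` (Q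
  integral) resp. `Q ↪ Q^pf` (Q torsion-free) — see `mem_groupSaturation_iff_grothendieckGroup`.
* **Topological groups** (pp.8–9): *co-free* and *minimal co-free* open normal subgroups (the
  category `B^temp(G)` of countable discrete `G`-sets is the [SemiAnbd] §3 notion, file
  `Literature/AnabelianGeometry/SemiGraphs/TemperedGroups.lean`, not duplicated here), with the printed consequence "a minimal co-free
  subgroup is necessarily unique and characteristic" PROVED (`IsMinimalCofree.unique`,
  `IsMinimalCofree.map_eq_of_continuousMulEquiv`). The word *tempered* (topological group that is
  an inverse limit of surjections of countable discrete groups) is [SemiAnbd] Def 3.1 (i) and is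
  owned by the [SemiAnbd] files (`Literature/AnabelianGeometry/SemiGraphs/`, seat abc-iut-L3-t2);
  it is not duplicated here.
* **Categories** (pp.9–10): *isomorph*, the categories `C_A` (= Mathlib `Over A`) and `C[A]`
  (full subcategory of objects admitting a morphism to `A`), *abstract equivalence* of arrows
  (= `Literature.AlgebraicGeometry.Frobenioids.IsAbstractlyEquivalent`, [FrdI] §0, reused),
  *isomorphism-full* faithful functors and their *essential image* (objects: Mathlib
  `Functor.essImage`; morphisms: `essImageHom`), with the printed observation that the essential
  image is closed under composition PROVED (`essImageHom_comp`).
* **Curves** (p.10): "split" stable log curves, stable/smooth log orbicurves, type `(1,1)±`,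
  hyperbolic orbicurves, "isogenous" — recorded below as documentation only. Per the cell's
  foundations audit (plan/FOUNDATIONS.md row 14: no log schemes in tranche 1) these objects enter
  §§1–5 of [EtTh] only through (a) the tempered-fundamental-group interface
  `Literature.AnabelianGeometry.SemiGraphs.TemperedCurveData` ([SemiAnbd] §3, seat abc-iut-L3-t2)
  and (b) the log-divisor interface of `TemperedFrobenioid.lean` ([EtTh] Def 3.1, Prop 3.2);
  nothing in this file asserts the existence of any curve.

Nothing here takes a side on any disputed claim; [EtTh] is a refereed 2009 paper.
-/

namespace Literature.AnabelianGeometry.EtaleTheta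

open Literature.AlgebraicGeometry.Frobenioids

universe u v

/-! ## Monoids (p.8) -/

section Monoids

variable {Q : Type u} [CommMonoid Q]

/-- The **group-saturation** `P^gp ∩ Q (⊆ Q^gp)` of a submonoid `P ⊆ Q` [EtTh §0, p.8]:
the elements `q ∈ Q` with `q · b = a` for some `a, b ∈ P` (i.e. `q = a b⁻¹ ∈ P^gp` inside
`Q^gp`; the text assumes `Q` integral so that `Q ⊆ Q^gp`). [cite: MochizukiEtTh2009, §0 p.8] -/
def groupSaturation (P : Submonoid Q) : Submonoid Q where
  carrier := {q | ∃ a ∈ P, ∃ b ∈ P, q * b = a}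
  one_mem' := ⟨1, P.one_mem, 1, P.one_mem, one_mul 1⟩
  mul_mem' := by
    rintro q q' ⟨a, ha, b, hb, h⟩ ⟨a', ha', b', hb', h'⟩
    exact ⟨a * a', P.mul_mem ha ha', b * b', P.mul_mem hb hb',
      by rw [mul_mul_mul_comm, h, h']⟩

/-- Membership in the group-saturation. [cite: MochizukiEtTh2009, §0 p.8] -/
theorem mem_groupSaturation_iff (P : Submonoid Q) (q : Q) :
    q ∈ groupSaturation P ↔ ∃ a ∈ P, ∃ b ∈ P, q * b = a := Iff.rfl

/-- `P ⊆ P^gp ∩ Q`. [cite: MochizukiEtTh2009, §0 p.8] -/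
theorem le_groupSaturation (P : Submonoid Q) : P ≤ groupSaturation P :=
  fun q hq => ⟨q, hq, 1, P.one_mem, mul_one q⟩

/-- For an integral (= cancellative) monoid `Q ↪ Q^gp`, `q ∈ P^gp ∩ Q` in the printed sense:
`q = a / b` in `Q^gp = Algebra.GrothendieckGroup Q` with `a, b ∈ P`.
[cite: MochizukiEtTh2009, §0 p.8] -/
theorem mem_groupSaturation_iff_grothendieckGroup [IsCancelMul Q] (P : Submonoid Q) (q : Q) :
    q ∈ groupSaturation P ↔ ∃ a ∈ P, ∃ b ∈ P,
      Algebra.GrothendieckGroup.of q = Algebra.GrothendieckGroup.of a / Algebra.GrothendieckGroup.of b := by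
  constructor
  · rintro ⟨a, ha, b, hb, h⟩
    exact ⟨a, ha, b, hb, by rw [eq_div_iff_mul_eq', ← map_mul, h]⟩
  · rintro ⟨a, ha, b, hb, h⟩
    refine ⟨a, ha, b, hb, Algebra.GrothendieckGroup.of_injective ?_⟩
    rw [map_mul, h, div_mul_cancel]

/-- `P` is **group-saturated** in `Q` if it equals its group-saturation [EtTh §0, p.8].
[cite: MochizukiEtTh2009, §0 p.8] -/
@[mk_iff] structure IsGroupSaturated (P : Submonoid Q) : Prop where
  /-- `P^gp ∩ Q ⊆ P` (the other inclusion always holds, `le_groupSaturation`) -/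
  groupSaturation_le : groupSaturation P ≤ P

/-- Unfolded form: `q · b = a` with `a, b ∈ P` forces `q ∈ P`. [cite: MochizukiEtTh2009, §0 p.8] -/
theorem isGroupSaturated_iff' (P : Submonoid Q) :
    IsGroupSaturated P ↔ ∀ q : Q, ∀ a ∈ P, ∀ b ∈ P, q * b = a → q ∈ P := by
  rw [isGroupSaturated_iff]
  exact ⟨fun h q a ha b hb e => h ⟨a, ha, b, hb, e⟩,
    fun h q ⟨a, ha, b, hb, e⟩ => h q a ha b hb e⟩

/-- The **perf-saturation** `P^pf ∩ Q (⊆ Q^pf)` of a submonoid `P ⊆ Q` [EtTh §0, p.8]: the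
elements `q ∈ Q` some positive power of which lies in `P` (the text assumes `Q` torsion-free so
that `Q ⊆ Q^pf`). [cite: MochizukiEtTh2009, §0 p.8] -/
def perfSaturation (P : Submonoid Q) : Submonoid Q where
  carrier := {q | ∃ n : ℕ+, q ^ (n : ℕ) ∈ P}
  one_mem' := ⟨1, by simp⟩
  mul_mem' := by
    rintro q q' ⟨n, hn⟩ ⟨m, hm⟩
    refine ⟨n * m, ?_⟩
    rw [mul_pow, PNat.mul_coe, pow_mul, mul_comm (n : ℕ) m, pow_mul]
    exact P.mul_mem (P.pow_mem hn _) (P.pow_mem hm _)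

/-- Membership in the perf-saturation. [cite: MochizukiEtTh2009, §0 p.8] -/
theorem mem_perfSaturation_iff (P : Submonoid Q) (q : Q) :
    q ∈ perfSaturation P ↔ ∃ n : ℕ+, q ^ (n : ℕ) ∈ P := Iff.rfl

/-- `P ⊆ P^pf ∩ Q`. [cite: MochizukiEtTh2009, §0 p.8] -/
theorem le_perfSaturation (P : Submonoid Q) : P ≤ perfSaturation P :=
  fun q hq => ⟨1, by simpa using hq⟩

/-- `P` is **perf-saturated** in `Q` if it equals its perf-saturation [EtTh §0, p.8].
[cite: MochizukiEtTh2009, §0 p.8] -/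
@[mk_iff] structure IsPerfSaturated (P : Submonoid Q) : Prop where
  /-- `P^pf ∩ Q ⊆ P` -/
  perfSaturation_le : perfSaturation P ≤ P

end Monoids

/-! ## Topological groups (pp.8–9) -/

section TopologicalGroups

open CategoryTheory

variable (G : Type u) [Group G] [TopologicalSpace G]

/-! `B^temp(G)` — "the category whose objects are countable [i.e., of cardinality ≤ the
cardinality of the set of natural numbers], discrete sets equipped with a continuous `G`-action
and whose morphisms are morphisms of `G`-sets [cf. [SemiAnbd], §3]" [EtTh §0, pp.8–9] — is the
[SemiAnbd] §3 notion and is owned by the [SemiAnbd] files: it is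
`Literature.AnabelianGeometry.SemiGraphs.BTemp` (file `SemiGraphs/TemperedGroups.lean`, seat
abc-iut-L3-t2), together with `IsTempered`; neither is re-declared here. -/

variable {G}

/-- A normal open subgroup `H ⊆ G` is **co-free** if `G/H` is a free group [EtTh §0, p.9].
[cite: MochizukiEtTh2009, §0 p.9] -/
@[mk_iff] structure IsCofree (H : Subgroup G) [H.Normal] : Prop where
  /-- `H` is open -/
  isOpen : IsOpen (H : Set G)
  /-- `G ⧸ H` is free -/
  isFreeGroup_quotient : IsFreeGroup (G ⧸ H)

/-- A co-free subgroup `H ⊆ G` is **minimal** if every co-free subgroup of `G` contains `H`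
[EtTh §0, p.9]. [cite: MochizukiEtTh2009, §0 p.9] -/
@[mk_iff] structure IsMinimalCofree (H : Subgroup G) [H.Normal] : Prop where
  /-- `H` is co-free -/
  isCofree : IsCofree H
  /-- every co-free subgroup contains `H` -/
  le_of_isCofree : ∀ (H' : Subgroup G) (hN : H'.Normal), @IsCofree G _ _ H' hN → H ≤ H'

/-- "Thus, a minimal co-free subgroup of `G` is necessarily unique …" [EtTh §0, p.9].
[cite: MochizukiEtTh2009, §0 p.9] -/
theorem IsMinimalCofree.unique {H₁ H₂ : Subgroup G} [H₁.Normal] [H₂.Normal]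
    (h₁ : IsMinimalCofree H₁) (h₂ : IsMinimalCofree H₂) : H₁ = H₂ :=
  le_antisymm (h₁.le_of_isCofree H₂ inferInstance h₂.isCofree)
    (h₂.le_of_isCofree H₁ inferInstance h₁.isCofree)

/-- The image of a co-free subgroup under an isomorphism of topological groups is co-free.
[cite: MochizukiEtTh2009, §0 p.9] -/
theorem IsCofree.map_continuousMulEquiv {H : Subgroup G} [hN : H.Normal] (h : IsCofree H)
    (φ : G ≃ₜ* G) :
    @IsCofree G _ _ (H.map φ.toMulEquiv.toMonoidHom)
      (hN.map φ.toMulEquiv.toMonoidHom φ.toMulEquiv.surjective) := by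
  haveI := hN.map φ.toMulEquiv.toMonoidHom φ.toMulEquiv.surjective
  refine ⟨?_, ?_⟩
  · rw [Subgroup.coe_map]
    exact φ.toHomeomorph.isOpenMap _ h.isOpen
  · haveI := h.isFreeGroup_quotient
    exact IsFreeGroup.ofMulEquiv (QuotientGroup.congr H _ φ.toMulEquiv rfl)

/-- "… and characteristic" [EtTh §0, p.9]: a minimal co-free subgroup is carried to itself by
every isomorphism of topological groups `G ≃ₜ* G`. [cite: MochizukiEtTh2009, §0 p.9] -/
theorem IsMinimalCofree.map_eq_of_continuousMulEquiv {H : Subgroup G} [hN : H.Normal]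
    (h : IsMinimalCofree H) (φ : G ≃ₜ* G) : H.map φ.toMulEquiv.toMonoidHom = H := by
  have key : ∀ ψ : G ≃ₜ* G, H ≤ H.map ψ.toMulEquiv.toMonoidHom := fun ψ =>
    h.le_of_isCofree _ _ (h.isCofree.map_continuousMulEquiv ψ)
  refine le_antisymm ?_ (key φ)
  calc H.map φ.toMulEquiv.toMonoidHom
      ≤ (H.map φ.symm.toMulEquiv.toMonoidHom).map φ.toMulEquiv.toMonoidHom :=
        Subgroup.map_mono (key φ.symm)
    _ = H := by
        rw [Subgroup.map_map]
        have hc : φ.toMulEquiv.toMonoidHom.comp φ.symm.toMulEquiv.toMonoidHom = MonoidHom.id G :=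
          MonoidHom.ext fun x => φ.apply_symm_apply x
        rw [hc, Subgroup.map_id]

end TopologicalGroups

/-! ## Categories (pp.9–10) -/

section Categories

open CategoryTheory

variable {C : Type u} [Category.{v} C]

/-- An **isomorph** of an object is an isomorphic copy of it [EtTh §0, p.9]; `IsIsomorph A B`
says `B` is an isomorph of `A`. [cite: MochizukiEtTh2009, §0 p.9] -/
def IsIsomorph (A B : C) : Prop := Nonempty (A ≅ B)

/-- `IsIsomorph` is reflexive. [cite: MochizukiEtTh2009, §0 p.9] -/
theorem IsIsomorph.refl (A : C) : IsIsomorph A A := ⟨Iso.refl A⟩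

/-- `IsIsomorph` is symmetric. [cite: MochizukiEtTh2009, §0 p.9] -/
theorem IsIsomorph.symm {A B : C} (h : IsIsomorph A B) : IsIsomorph B A := ⟨h.some.symm⟩

/-- `IsIsomorph` is transitive. [cite: MochizukiEtTh2009, §0 p.9] -/
theorem IsIsomorph.trans {A B D : C} (h₁ : IsIsomorph A B) (h₂ : IsIsomorph B D) :
    IsIsomorph A D := ⟨h₁.some.trans h₂.some⟩

/-- The category `C_A` of arrows `B → A` with `A`-morphisms [EtTh §0, p.9; [FrdI] §0] is Mathlib's
`Over A` (= `Literature.AlgebraicGeometry.Frobenioids.sliceOver`). [cite: MochizukiEtTh2009, §0 p.9] -/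
abbrev sliceCat (A : C) := Over A

/-- The object property "admits a morphism to `A`" defining `C[A] ⊆ C` [EtTh §0, p.9].
[cite: MochizukiEtTh2009, §0 p.9] -/
def admitsMorphismTo (A : C) : ObjectProperty C := fun B => Nonempty (B ⟶ A)

/-- `C[A] ⊆ C`: "the full subcategory of `C` determined by the objects of `C` that admit a
morphism to `A`" [EtTh §0, p.9]. [cite: MochizukiEtTh2009, §0 p.9] -/
abbrev bracketCat (A : C) := (admitsMorphismTo A).FullSubcategory

/-- `A` itself lies in `C[A]`. [cite: MochizukiEtTh2009, §0 p.9] -/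
theorem admitsMorphismTo_self (A : C) : admitsMorphismTo A A := ⟨𝟙 A⟩

/-- `C[A]` is closed under passing to sources of morphisms: if `B → B'` and `B' ∈ C[A]` then
`B ∈ C[A]`. [cite: MochizukiEtTh2009, §0 p.9] -/
theorem admitsMorphismTo_of_hom {A B B' : C} (f : B ⟶ B') (h : admitsMorphismTo A B') :
    admitsMorphismTo A B := ⟨f ≫ h.some⟩

/-! Abstract equivalences of arrows [EtTh §0, p.9] are the `IsAbstractlyEquivalent` of
[FrdI] §0 (`Literature.AlgebraicGeometry.Frobenioids.IsAbstractlyEquivalent`), reused verbatim. -/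

variable {D : Type*} [Category D]

/-- A faithful functor `Φ : C → D` is **isomorphism-full** if every isomorphism
`Φ(A) ≅ Φ(B)` of `D` arises by applying `Φ` to an isomorphism `A ≅ B` of `C` [EtTh §0, p.9].
(Faithfulness is part of the printed context and is recorded as a field.)
[cite: MochizukiEtTh2009, §0 p.9] -/
@[mk_iff] structure IsIsomorphismFull (Φ : C ⥤ D) : Prop where
  /-- `Φ` is faithful -/
  faithful : Φ.Faithful
  /-- every isomorphism between images of objects lifts to an isomorphism -/
  exists_mapIso_eq : ∀ (A B : C) (e : Φ.obj A ≅ Φ.obj B), ∃ f : A ≅ B, Φ.mapIso f = e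

/-- Objects of the **essential image** of `Φ`: "the objects of `D` that are isomorphic to objects
in the image of `Φ`" [EtTh §0, pp.9–10] — Mathlib's `Functor.essImage`, recorded under the
source's name. [cite: MochizukiEtTh2009, §0 p.10] -/
abbrev essImageObj (Φ : C ⥤ D) : ObjectProperty D := Φ.essImage

/-- Morphisms of the **essential image** of `Φ`: "the morphisms of `D` that are abstractly
equivalent to morphisms in the image of `Φ`" [EtTh §0, pp.9–10].
[cite: MochizukiEtTh2009, §0 p.10] -/
def essImageHom (Φ : C ⥤ D) : MorphismProperty D := fun _ _ f =>
  ∃ (A B : C) (g : A ⟶ B), IsAbstractlyEquivalent (Φ.map g) f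

/-- Morphisms in the image of `Φ` lie in the essential image. [cite: MochizukiEtTh2009, §0 p.10] -/
theorem essImageHom_map (Φ : C ⥤ D) {A B : C} (g : A ⟶ B) : essImageHom Φ (Φ.map g) :=
  ⟨A, B, g, IsAbstractlyEquivalent.refl _⟩

/-- Identities of objects of the essential image lie in the essential image.
[cite: MochizukiEtTh2009, §0 p.10] -/
theorem essImageHom_id (Φ : C ⥤ D) {X : D} (hX : essImageObj Φ X) : essImageHom Φ (𝟙 X) := by
  obtain ⟨A, ⟨e⟩⟩ := hX
  exact ⟨A, A, 𝟙 A, ⟨Arrow.isoMk' (Φ.map (𝟙 A)) (𝟙 X) e e (by simp)⟩⟩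

/-- Unpacking an isomorphism of arrows `(f : W → X) ≅ (g : Y → Z)` into isomorphisms `W ≅ Y`,
`X ≅ Z` at the expected types together with the commutative square. [folklore] -/
private theorem exists_iso_of_arrow_iso {W X Y Z : D} {f : W ⟶ X} {g : Y ⟶ Z}
    (e : Arrow.mk f ≅ Arrow.mk g) : ∃ (e₁ : W ≅ Y) (e₂ : X ≅ Z), e₁.hom ≫ g = f ≫ e₂.hom :=
  ⟨Arrow.leftFunc.mapIso e, Arrow.rightFunc.mapIso e, Arrow.w e.hom⟩

/-- Source and target of a morphism of the essential image are objects of the essential image.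
[cite: MochizukiEtTh2009, §0 p.10] -/
theorem essImageObj_of_essImageHom (Φ : C ⥤ D) {X Y : D} {f : X ⟶ Y} (hf : essImageHom Φ f) :
    essImageObj Φ X ∧ essImageObj Φ Y := by
  obtain ⟨A, B, g, ⟨e⟩⟩ := hf
  obtain ⟨eA, eB, -⟩ := exists_iso_of_arrow_iso e
  exact ⟨⟨A, ⟨eA⟩⟩, ⟨B, ⟨eB⟩⟩⟩

/-- "Suppose that `Φ` is isomorphism-full. Then observe that the objects of `D` that are isomorphic
to objects in the image of `Φ`, together with the morphisms of `D` that are abstractly equivalent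
to morphisms in the image of `Φ`, form a subcategory `C' ⊆ D`" [EtTh §0, p.9]: the composition
clause, PROVED (isomorphism-fullness glues the two abstract equivalences).
[cite: MochizukiEtTh2009, §0 p.9] -/
theorem essImageHom_comp {Φ : C ⥤ D} (hΦ : IsIsomorphismFull Φ) {X Y Z : D} {f : X ⟶ Y}
    {f' : Y ⟶ Z} (hf : essImageHom Φ f) (hf' : essImageHom Φ f') : essImageHom Φ (f ≫ f') := by
  obtain ⟨A₁, B₁, g₁, ⟨e₁⟩⟩ := hf
  obtain ⟨A₂, B₂, g₂, ⟨e₂⟩⟩ := hf'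
  obtain ⟨eA₁, eB₁, w₁⟩ := exists_iso_of_arrow_iso e₁
  obtain ⟨eA₂, eB₂, w₂⟩ := exists_iso_of_arrow_iso e₂
  -- `Φ B₁ ≅ Y ≅ Φ A₂` lifts to `k : B₁ ≅ A₂` by isomorphism-fullness
  obtain ⟨k, hk⟩ := hΦ.exists_mapIso_eq B₁ A₂ (eB₁.trans eA₂.symm)
  have hk' : Φ.map k.hom = eB₁.hom ≫ eA₂.inv := by
    simpa using congrArg Iso.hom hk
  refine ⟨A₁, B₂, g₁ ≫ k.hom ≫ g₂, ⟨Arrow.isoMk' _ _ eA₁ eB₂ ?_⟩⟩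
  simp only [Functor.map_comp, Category.assoc, hk']
  rw [reassoc_of% w₁, ← w₂, eA₂.inv_hom_id_assoc]

/-! The further printed clause "such that `Φ` induces an equivalence of categories `C ⥤ C'`"
(p.9) requires `C'` as a category in its own right; it is not formalised in this file (no
statement is recorded for it). -/

end Categories

/-! ## Curves (p.10) — documentation only

"We refer to [SemiAnbd], §0, for generalities concerning [families of] hyperbolic curves, smooth
log curves, stable log curves, divisors of cusps, and divisors of marked points. If
`C^log → S^log` is a stable log curve, and, moreover, `S` is the spectrum of a field, then we shall
say that `C^log` is *split* if each of the irreducible components and nodes of `C` is geometrically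
irreducible over `S`." Then: *stable log orbicurve* / *smooth log orbicurve* over `S^log`
(quotients, in the sense of log stacks, of stable/smooth log curves by finite groups acting
freely on a dense open of every fibre), type `(1,1)±` (quotient of a type-`(1,1)` curve by `±1`),
*hyperbolic orbicurve* (remove the divisor of cusps from a smooth log orbicurve over a field),
*isogenous* hyperbolic orbicurves `X`, `Y` (∃ hyperbolic curve `Z` with finite étale `Z → X`,
`Z → Y`). [EtTh §0, p.10]. These notions are consumed in [EtTh] §§1–5 only through interface
structures (see the module docstring); no declaration is made for them here. -/

end Literature.AnabelianGeometry.EtaleTheta
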